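import Summits.Ventures.Crystal3D.Theorems.StickyWulffConstantGenericWallFloorHRowEndDozen
import Summits.Ventures.Crystal3D.Theorems.StickyWulffConstantGenericWallFloorDozenRigidity
import Summits.Ventures.Crystal3D.Theorems.StickyWulffConstantGenericWallFloorCapStartBarlow
import Summits.Ventures.Crystal3D.Theorems.StickyWulffConstantCoaxialWallLawJammedMono
import HarnessLib

/-!
# The h-row END theorem in the model direction `u₀`, I: the ADJACENT cases `p′ ∈ {p, p + F t₁, …, p + F t₄}` (core of TRACK 2′ for `HRowEndFarApart (3/4)`)
# (crux `GenericWallFloor`, stmt-Ventures-19480, kernel G; machine owner 19480-p2 g14, 2026-08-29)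

HONEST FRAMING. Venture `Summits/Ventures/Crystal3D` (cell `crystal3d-full`), route `route-Ventures-StickyWulffConstant`, helper for the crux
`GenericWallFloor` (stmt-Ventures-19480) / consumer `TextureLiminfV5` (stmt-Ventures-23912).  Standard axioms; no `sorry`; F-C1 not moved.
Ingredients: dozen rigidity (`movedFcc_eq_of_three_independent_slots`), model data (`…HRowEndModel`), the unified dozen interface `InDoz` and the
VERTICAL-PAIR lemma (`…HRowEndDozen`).

THE SETTING (section `Core`, shared with `…HRowEndCore`).  Frame `F`, row direction `F u₀`, h-full predecessor `p` (`p + F t ∈ X` for `t ∈ hcpSlots`),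
end ball `e = p + F u₀`; a strongly certified `⟨F′, q, 0⟩` at `e` with predecessor `p′ = e − F′ q = p + F u₀ − F d` (`F d = F′ q`, `d` the model
direction) whose near balls are described by the dozen interface `InDoz F′ n₀` (`n₀ = 0`: slot dozen; `‖n₀‖ = 1`: twin dozen with menu normal `n₀`,
`F′ q` reading `√(2/3)`); `F′·Λ₀` apart from `F·Λ₀` (`hA`) and from its basal twin (`hB`).
THE CASES HERE.  `p′ = p` (`case_self`), `p′ = p + F t₁` / `t₂` (`case_t₁`, `case_t₂`): a VERTICAL PAIR (`t₃,t₄` resp. `t₅,t₆`, inner product `−1/3`)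
of `p`'s h-dozen lies in `D′` — impossible (`vertical_pair`: slots never read `−1/3`, and a twin pair reveals `n₀ = ±F e₃`, orthogonal to the in-plane
arrival `F′ q`, contradicting its positive reading).  `p′ = p + F t₃` / `t₄` (`case_t₃`, `case_t₄` — the configurations refuting the coaxial-blind
`HRowEndFar`): three independent shared slots (`−t₃, u₀ − t₃, t₁ − t₃`, resp. their basal mirrors) put `F′·Λ₀ = F·Λ₀` resp. `= twin` by dozen
rigidity (`coaxial_contra`, `coaxial_contra_twin`) — excluded by APARTNESS.  The far case and the assembly are in `…HRowEndCore`.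
-/

noncomputable section

namespace Summit.Ventures.Crystal3D.Theorems

open Finset
open Literature.MathematicalPhysics.StatisticalMechanics
open scoped InnerProductSpace

namespace HRowEndModel

section Core

variable {X : Finset (EuclideanSpace ℝ (Fin 3))} (hX : ∀ p ∈ X, ∀ q ∈ X, p ≠ q → 1 ≤ dist p q)
  {F F' : EuclideanSpace ℝ (Fin 3) ≃ₗᵢ[ℝ] EuclideanSpace ℝ (Fin 3)} {q n₀ d p : EuclideanSpace ℝ (Fin 3)}
  (hq : q ∈ fccSlots) (hn : n₀ = 0 ∨ ‖n₀‖ = 1)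
  (hmenu : ∀ w ∈ fccSlots, ⟪F' w, n₀⟫_ℝ = 0 ∨ ⟪F' w, n₀⟫_ℝ = Real.sqrt (2 / 3) ∨ ⟪F' w, n₀⟫_ℝ = -Real.sqrt (2 / 3))
  (hposOr : n₀ = 0 ∨ 0 < ⟪F' q, n₀⟫_ℝ) (hFd : F d = F' q) (hd1 : ‖d‖ = 1)
  (hball : ∀ t ∈ hcpSlots, p + F t ∈ X) (hpX : p ∈ X)
  (hdoz : ∀ x ∈ X, x ≠ p + F u₀ - F d → dist x (p + F u₀ - F d) < Real.sqrt 2 → InDoz F' n₀ (x - (p + F u₀ - F d)))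
  (hA : F' '' fccStacking 1 (Real.sqrt (2 / 3)) ≠ F '' fccStacking 1 (Real.sqrt (2 / 3)))
  (hB : F' '' fccStacking 1 (Real.sqrt (2 / 3)) ≠
    (twinFrame F (F (EuclideanSpace.single (2 : Fin 3) (1 : ℝ)))) '' fccStacking 1 (Real.sqrt (2 / 3)))

include hdoz in
/-- Distances from `p′ = p + F u₀ − F d` in model terms, and dozen membership of a ball `p + F v` at unit distance. -/
theorem inDoz_of_unit {v : EuclideanSpace ℝ (Fin 3)} (hv : p + F v ∈ X) (h1 : ‖v - u₀ + d‖ = 1) : InDoz F' n₀ (F (v - u₀ + d)) := by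
  have key : p + F v - (p + F u₀ - F d) = F (v - u₀ + d) := by rw [map_add, map_sub]; abel
  have hdist : dist (p + F v) (p + F u₀ - F d) = 1 := by rw [dist_eq_norm, key, LinearIsometryEquiv.norm_map, h1]
  have hne : p + F v ≠ p + F u₀ - F d := by
    intro h; rw [h, dist_self] at hdist; exact zero_ne_one hdist
  have hlt : dist (p + F v) (p + F u₀ - F d) < Real.sqrt 2 := by
    rw [hdist, show (1 : ℝ) = Real.sqrt 1 by simp]; exact Real.sqrt_lt_sqrt (by norm_num) (by norm_num)
  have := hdoz (p + F v) hv hne hlt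
  rwa [key] at this

include hq hn hmenu hposOr hFd in
/-- A dozen vector at unit distance from `F d = F′ q` is a slot (in the cap case `F′ q` reads `√(2/3)`). -/
theorem slot_of_near {x : EuclideanSpace ℝ (Fin 3)} (hx : InDoz F' n₀ x) (h1 : ‖x - F d‖ = 1) : ∃ w ∈ fccSlots, x = F' w := by
  rcases hposOr with h0 | hpos
  · obtain ⟨w, hw, h⟩ := hx
    rcases h with ⟨-, hxw⟩ | ⟨hp, -⟩
    · exact ⟨w, hw, hxw⟩
    · rw [h0, inner_zero_right] at hp; exact absurd hp (lt_irrefl 0)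
  · have hv : Real.sqrt (2 / 3) ≤ ⟪F d, n₀⟫_ℝ := by rw [hFd]; exact (reading_of_pos hn hmenu hq hpos).1.symm.le
    exact slot_of_sub_unit hn hmenu hv h1 hx

/-- Dozen vectors are unit vectors. -/
theorem norm_of_inDoz (hn : n₀ = 0 ∨ ‖n₀‖ = 1)
    (hmenu : ∀ w ∈ fccSlots, ⟪F' w, n₀⟫_ℝ = 0 ∨ ⟪F' w, n₀⟫_ℝ = Real.sqrt (2 / 3) ∨ ⟪F' w, n₀⟫_ℝ = -Real.sqrt (2 / 3))
    {x : EuclideanSpace ℝ (Fin 3)} (hx : InDoz F' n₀ x) : ‖x‖ = 1 := by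
  obtain ⟨w, hw, h⟩ := hx
  have hFw : ‖F' w‖ = 1 := by rw [LinearIsometryEquiv.norm_map, norm_eq_one_of_mem_fccSlots hw]
  rcases h with ⟨-, rfl⟩ | ⟨hpos, rfl⟩
  · exact hFw
  · obtain ⟨hval, hn1⟩ := reading_of_pos hn hmenu hw hpos
    have : F' w - (2 * Real.sqrt (2 / 3)) • n₀ = (ℝ ∙ n₀)ᗮ.reflection (F' w) := by rw [reflection_unit_apply hn1, hval]
    rw [this, LinearIsometryEquiv.norm_map, hFw]

include hn hmenu hposOr hFd in
/-- **Vertical-pair contradiction**: `F a, F b ∈ D′` with `⟪a,b⟫ = −1/3`, `a − b = 2√(2/3)·e₃` and the arrival in-plane (`d 2 = 0`) is impossible. -/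
theorem vert_contra {a b : EuclideanSpace ℝ (Fin 3)} (hab : ⟪a, b⟫_ℝ = -1 / 3)
    (hsub : a - b = (2 * Real.sqrt (2 / 3)) • EuclideanSpace.single (2 : Fin 3) (1 : ℝ)) (hd2 : d 2 = 0)
    (hFa : InDoz F' n₀ (F a)) (hFb : InDoz F' n₀ (F b)) : False := by
  have hc : 0 < Real.sqrt (2 / 3) := sqrt23_pos
  obtain ⟨c, hc1, hdiff, w, hw, hwpos⟩ := vertical_pair hn hmenu hab hFa hFb
  have h1 : F a - F b = (2 * Real.sqrt (2 / 3)) • F (EuclideanSpace.single (2 : Fin 3) (1 : ℝ)) := by rw [← map_sub, hsub, map_smul]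
  rw [h1] at hdiff
  have hc2 : c * c = 1 := by rcases hc1 with rfl | rfl <;> norm_num
  have hn0 : n₀ = c • F (EuclideanSpace.single (2 : Fin 3) (1 : ℝ)) := by
    have h2 : F (EuclideanSpace.single (2 : Fin 3) (1 : ℝ)) = c • n₀ := by
      have h3 : (2 * Real.sqrt (2 / 3)) • (F (EuclideanSpace.single (2 : Fin 3) (1 : ℝ)) - c • n₀) = 0 := by
        rw [smul_sub, hdiff, smul_smul]; ring_nf; simp
      rcases smul_eq_zero.1 h3 with h | h
      · exfalso; linarith
      · exact sub_eq_zero.1 h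
    rw [h2, smul_smul, hc2, one_smul]
  have hne : n₀ ≠ 0 := fun h => by rw [h, inner_zero_right] at hwpos; exact lt_irrefl _ hwpos
  have hpos : 0 < ⟪F' q, n₀⟫_ℝ := by
    rcases hposOr with h | h
    · exact absurd h hne
    · exact h
  rw [hn0, ← hFd, real_inner_smul_right, LinearIsometryEquiv.inner_map_map, EuclideanSpace.inner_single_right] at hpos
  simp [hd2] at hpos

include hq hn hmenu hposOr hFd hA in
/-- **Three shared slots of `F` force `F′·Λ₀ = F·Λ₀`** (used for `p′ = p + F t₃` and for the lower octahedral configuration): model slots `a₁ a₂ a₃`,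
pairwise… given directly as: `F aᵢ ∈ D′` at unit distance from `F d`, `aᵢ ∈ fccSlots`, independent ⇒ contradiction with apartness. -/
theorem coaxial_contra {a₁ a₂ a₃ : EuclideanSpace ℝ (Fin 3)} (h₁ : a₁ ∈ fccSlots) (h₂ : a₂ ∈ fccSlots) (h₃ : a₃ ∈ fccSlots)
    (hind : LinearIndependent ℝ ![a₁, a₂, a₃])
    (hD₁ : InDoz F' n₀ (F a₁)) (hD₂ : InDoz F' n₀ (F a₂)) (hD₃ : InDoz F' n₀ (F a₃))
    (hn₁ : ‖F a₁ - F d‖ = 1) (hn₂ : ‖F a₂ - F d‖ = 1 ∨ a₂ = d) (hn₃ : ‖F a₃ - F d‖ = 1) : False := by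
  have slot : ∀ {a : EuclideanSpace ℝ (Fin 3)}, InDoz F' n₀ (F a) → (‖F a - F d‖ = 1 ∨ a = d) →
      F a ∈ F' '' fccStacking 1 (Real.sqrt (2 / 3)) := by
    intro a hD hnd
    rcases hnd with h | h
    · obtain ⟨w, hw, hFa⟩ := slot_of_near hq hn hmenu hposOr hFd hD h
      exact ⟨w, mem_fcc_of_mem_fccSlots hw, hFa.symm⟩
    · rw [h, hFd]; exact ⟨q, mem_fcc_of_mem_fccSlots hq, rfl⟩
  have key := movedFcc_eq_of_three_independent_slots F F' h₁ h₂ h₃ (slot hD₁ (Or.inl hn₁)) (slot hD₂ hn₂) (slot hD₃ (Or.inl hn₃)) hind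
  exact hA key.symm

include hq hn hmenu hposOr hFd hB in
/-- **Three shared slots of the basal twin force `F′·Λ₀ = (twinFrame F (F e₃))·Λ₀`** — contradiction with apartness. -/
theorem coaxial_contra_twin {a₁ a₂ a₃ : EuclideanSpace ℝ (Fin 3)} (h₁ : a₁ ∈ fccSlots) (h₂ : a₂ ∈ fccSlots) (h₃ : a₃ ∈ fccSlots)
    (hind : LinearIndependent ℝ ![a₁, a₂, a₃])
    (hD₁ : InDoz F' n₀ (F (basalMirror a₁))) (hD₂ : InDoz F' n₀ (F (basalMirror a₂))) (hD₃ : InDoz F' n₀ (F (basalMirror a₃)))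
    (hn₁ : ‖F (basalMirror a₁) - F d‖ = 1) (hn₂ : ‖F (basalMirror a₂) - F d‖ = 1 ∨ basalMirror a₂ = d)
    (hn₃ : ‖F (basalMirror a₃) - F d‖ = 1) : False := by
  set G := twinFrame F (F (EuclideanSpace.single (2 : Fin 3) (1 : ℝ))) with hG
  have hGa : ∀ a, G a = F (basalMirror a) := fun a => twinFrame_axis_apply F a
  have slot : ∀ {a : EuclideanSpace ℝ (Fin 3)}, InDoz F' n₀ (F (basalMirror a)) → (‖F (basalMirror a) - F d‖ = 1 ∨ basalMirror a = d) →
      G a ∈ F' '' fccStacking 1 (Real.sqrt (2 / 3)) := by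
    intro a hD hnd
    rw [hGa]
    rcases hnd with h | h
    · obtain ⟨w, hw, hFa⟩ := slot_of_near hq hn hmenu hposOr hFd hD h
      exact ⟨w, mem_fcc_of_mem_fccSlots hw, hFa.symm⟩
    · rw [h, hFd]; exact ⟨q, mem_fcc_of_mem_fccSlots hq, rfl⟩
  have key := movedFcc_eq_of_three_independent_slots G F' h₁ h₂ h₃ (slot hD₁ (Or.inl hn₁)) (slot hD₂ hn₂) (slot hD₃ (Or.inl hn₃)) hind
  exact hB key.symm

/-! ### The cases -/

include hn hmenu hposOr hFd hball hdoz in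
/-- **(C1) `p′ = p`** (`d = u₀`). -/
theorem case_self (hdu : d = u₀) : False := by
  have hm3 := inDoz_of_unit hdoz (hball t₃ t₃_hcp) (by rw [hdu, sub_add_cancel]; exact norm_eq_one_of_mem_fccSlots t₃_mem)
  have hm4 := inDoz_of_unit hdoz (hball t₄ t₄_hcp) (by rw [hdu, sub_add_cancel]; exact norm_t₄)
  rw [hdu, sub_add_cancel] at hm3 hm4
  exact vert_contra hn hmenu hposOr hFd inner_t₃_t₄ t₃_sub_t₄ (by rw [hdu]; exact u₀_two) hm3 hm4

include hn hmenu hposOr hFd hball hdoz in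
/-- **(C2) `p′ = p + F t₁`**: the vertical pair `t₃ − t₁`, `t₄ − t₁`. -/
theorem case_t₁ (hds : d = u₀ - t₁) : False := by
  have n1 := norm_eq_one_of_mem_fccSlots t₁_mem
  have n3 : ‖t₃ - t₁‖ = 1 := TailResidue.norm_sub_eq_one_of_inner_half (norm_eq_one_of_mem_fccSlots t₃_mem) n1 inner_t₃_t₁
  have n4 : ‖t₄ - t₁‖ = 1 := TailResidue.norm_sub_eq_one_of_inner_half norm_t₄ n1 inner_t₄_t₁
  have e3 : t₃ - u₀ + d = t₃ - t₁ := by rw [hds]; abel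
  have e4 : t₄ - u₀ + d = t₄ - t₁ := by rw [hds]; abel
  have hm3 := inDoz_of_unit hdoz (hball t₃ t₃_hcp) (by rw [e3]; exact n3)
  have hm4 := inDoz_of_unit hdoz (hball t₄ t₄_hcp) (by rw [e4]; exact n4)
  rw [e3] at hm3; rw [e4] at hm4
  refine vert_contra hn hmenu hposOr hFd (a := t₃ - t₁) (b := t₄ - t₁) ?_ (by rw [← t₃_sub_t₄]; abel)
    (by rw [hds, PiLp.sub_apply, u₀_two, t₁_apply.2.2, sub_zero]) hm3 hm4
  have h11 : ⟪t₁, t₁⟫_ℝ = 1 := by rw [real_inner_self_eq_norm_sq, n1, one_pow]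
  rw [inner_sub_left, inner_sub_right, inner_sub_right, inner_t₃_t₄, inner_t₃_t₁, real_inner_comm t₄ t₁, inner_t₄_t₁, h11]; ring

include hn hmenu hposOr hFd hball hdoz in
/-- **(C2′) `p′ = p + F t₂`**: the vertical pair `t₅ − t₂`, `t₆ − t₂`. -/
theorem case_t₂ (hds : d = u₀ - t₂) : False := by
  have n2 := norm_eq_one_of_mem_fccSlots t₂_mem
  have n5 : ‖t₅ - t₂‖ = 1 := TailResidue.norm_sub_eq_one_of_inner_half (norm_eq_one_of_mem_fccSlots t₅_mem) n2 inner_t₅_t₂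
  have n6 : ‖t₆ - t₂‖ = 1 := TailResidue.norm_sub_eq_one_of_inner_half norm_t₆ n2 inner_t₆_t₂
  have e5 : t₅ - u₀ + d = t₅ - t₂ := by rw [hds]; abel
  have e6 : t₆ - u₀ + d = t₆ - t₂ := by rw [hds]; abel
  have hm5 := inDoz_of_unit hdoz (hball t₅ t₅_hcp) (by rw [e5]; exact n5)
  have hm6 := inDoz_of_unit hdoz (hball t₆ t₆_hcp) (by rw [e6]; exact n6)
  rw [e5] at hm5; rw [e6] at hm6
  refine vert_contra hn hmenu hposOr hFd (a := t₅ - t₂) (b := t₆ - t₂) ?_ (by rw [← t₅_sub_t₆]; abel)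
    (by rw [hds, PiLp.sub_apply, u₀_two, t₂_apply.2.2, sub_zero]) hm5 hm6
  have h22 : ⟪t₂, t₂⟫_ℝ = 1 := by rw [real_inner_self_eq_norm_sq, n2, one_pow]
  rw [inner_sub_left, inner_sub_right, inner_sub_right, inner_t₅_t₆, inner_t₅_t₂, real_inner_comm t₆ t₂, inner_t₆_t₂, h22]; ring

/-- The three slots `−t₃, u₀ − t₃, t₁ − t₃` (the refuting witness's shared balls, read from `z = p + F t₃`): memberships, adjacencies, independence. -/
theorem witness_slots : -t₃ ∈ fccSlots ∧ u₀ - t₃ ∈ fccSlots ∧ t₁ - t₃ ∈ fccSlots ∧ LinearIndependent ℝ ![-t₃, u₀ - t₃, t₁ - t₃] := by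
  have h1 : -t₃ ∈ fccSlots := neg_mem_fccSlots t₃_mem
  have hut : ⟪u₀, t₃⟫_ℝ = 1 / 2 := by rw [real_inner_comm]; exact inner_t₃_u₀
  have h2 : u₀ - t₃ ∈ fccSlots := sub_mem_fccSlots_of_inner_eq_half u₀_mem t₃_mem hut
  have h13 : ⟪t₁, t₃⟫_ℝ = 1 / 2 := by rw [real_inner_comm]; exact inner_t₃_t₁
  have h3 : t₁ - t₃ ∈ fccSlots := sub_mem_fccSlots_of_inner_eq_half t₁_mem t₃_mem h13
  have h33 : ⟪t₃, t₃⟫_ℝ = 1 := by rw [real_inner_self_eq_norm_sq, norm_eq_one_of_mem_fccSlots t₃_mem, one_pow]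
  have hu1 : ⟪u₀, t₁⟫_ℝ = 1 / 2 := by rw [real_inner_comm]; exact inner_t₁_u₀
  refine ⟨h1, h2, h3, linearIndependent_of_pairwise_half h1 h2 h3 ?_ ?_ ?_⟩
  · rw [inner_neg_left, inner_sub_right, real_inner_comm u₀ t₃, hut, h33]; norm_num
  · rw [inner_neg_left, inner_sub_right, real_inner_comm t₁ t₃, h13, h33]; norm_num
  · rw [inner_sub_left, inner_sub_right, inner_sub_right, hu1, hut, real_inner_comm t₁ t₃, h13, h33]; norm_num

include hq hn hmenu hposOr hFd hd1 hball hpX hdoz hA in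
/-- **(C3) `p′ = p + F t₃`** (the coherent upper case): `p, e, p + F t₁` are in `D′`, pinning `F′·Λ₀ = F·Λ₀`. -/
theorem case_t₃ (hds : d = u₀ - t₃) : False := by
  obtain ⟨h1, h2, h3, hind⟩ := witness_slots
  have hu1 := norm_eq_one_of_mem_fccSlots u₀_mem
  -- the three balls at unit distance from `p′`
  have hm_p : InDoz F' n₀ (F (-t₃)) := by
    have := inDoz_of_unit hdoz (v := 0) (by rw [map_zero, add_zero]; exact hpX)
      (by rw [hds, zero_sub, show -u₀ + (u₀ - t₃) = -t₃ by abel]; exact norm_eq_one_of_mem_fccSlots h1)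
    rwa [zero_sub, hds, show -u₀ + (u₀ - t₃) = -t₃ by abel] at this
  have hm_e : InDoz F' n₀ (F (u₀ - t₃)) := by
    have := inDoz_of_unit hdoz (hball u₀ u₀_hcp) (by rw [sub_self, zero_add]; exact hd1)
    rwa [sub_self, zero_add, hds] at this
  have hm_e' : InDoz F' n₀ (F (t₁ - t₃)) := by
    have := inDoz_of_unit hdoz (hball t₁ t₁_hcp) (by rw [hds, show t₁ - u₀ + (u₀ - t₃) = t₁ - t₃ by abel]; exact norm_eq_one_of_mem_fccSlots h3)
    rwa [hds, show t₁ - u₀ + (u₀ - t₃) = t₁ - t₃ by abel] at this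
  refine coaxial_contra hq hn hmenu hposOr hFd hA h1 h2 h3 hind hm_p hm_e hm_e' ?_ (Or.inr hds.symm) ?_
  · rw [← map_sub, LinearIsometryEquiv.norm_map, hds, show -t₃ - (u₀ - t₃) = -u₀ by abel, norm_neg, hu1]
  · rw [← map_sub, LinearIsometryEquiv.norm_map, hds, show t₁ - t₃ - (u₀ - t₃) = t₁ - u₀ by abel]
    exact TailResidue.norm_sub_eq_one_of_inner_half (norm_eq_one_of_mem_fccSlots t₁_mem) hu1 inner_t₁_u₀

include hq hn hmenu hposOr hFd hd1 hball hpX hdoz hB in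
/-- **(C3′) `p′ = p + F t₄`** (the coherent lower case = the refuting witness): the same three balls pin the BASAL TWIN. -/
theorem case_t₄ (hds : d = u₀ - t₄) : False := by
  obtain ⟨h1, h2, h3, hind⟩ := witness_slots
  have hu1 := norm_eq_one_of_mem_fccSlots u₀_mem
  have hMu : basalMirror u₀ = u₀ := basalMirror_of_inPlane u₀_two
  have hMt₁ : basalMirror t₁ = t₁ := basalMirror_of_inPlane t₁_apply.2.2
  have hM1 : basalMirror (-t₃) = -t₄ := by rw [map_neg]; rfl
  have hM2 : basalMirror (u₀ - t₃) = u₀ - t₄ := by rw [map_sub, hMu]; rfl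
  have hM3 : basalMirror (t₁ - t₃) = t₁ - t₄ := by rw [map_sub, hMt₁]; rfl
  have hm_p : InDoz F' n₀ (F (basalMirror (-t₃))) := by
    rw [hM1]
    have := inDoz_of_unit hdoz (v := 0) (by rw [map_zero, add_zero]; exact hpX)
      (by rw [hds, zero_sub, show -u₀ + (u₀ - t₄) = -t₄ by abel, norm_neg]; exact norm_t₄)
    rwa [zero_sub, hds, show -u₀ + (u₀ - t₄) = -t₄ by abel] at this
  have hm_e : InDoz F' n₀ (F (basalMirror (u₀ - t₃))) := by
    rw [hM2]
    have := inDoz_of_unit hdoz (hball u₀ u₀_hcp) (by rw [sub_self, zero_add]; exact hd1)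
    rwa [sub_self, zero_add, hds] at this
  have n14 : ‖t₁ - t₄‖ = 1 := TailResidue.norm_sub_eq_one_of_inner_half (norm_eq_one_of_mem_fccSlots t₁_mem) norm_t₄ (by rw [real_inner_comm]; exact inner_t₄_t₁)
  have hm_e' : InDoz F' n₀ (F (basalMirror (t₁ - t₃))) := by
    rw [hM3]
    have := inDoz_of_unit hdoz (hball t₁ t₁_hcp) (by rw [hds, show t₁ - u₀ + (u₀ - t₄) = t₁ - t₄ by abel]; exact n14)
    rwa [hds, show t₁ - u₀ + (u₀ - t₄) = t₁ - t₄ by abel] at this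
  refine coaxial_contra_twin hq hn hmenu hposOr hFd hB h1 h2 h3 hind hm_p hm_e hm_e' ?_ (Or.inr (by rw [hM2, hds])) ?_
  · rw [hM1, ← map_sub, LinearIsometryEquiv.norm_map, hds, show -t₄ - (u₀ - t₄) = -u₀ by abel, norm_neg, hu1]
  · rw [hM3, ← map_sub, LinearIsometryEquiv.norm_map, hds, show t₁ - t₄ - (u₀ - t₄) = t₁ - u₀ by abel]
    exact TailResidue.norm_sub_eq_one_of_inner_half (norm_eq_one_of_mem_fccSlots t₁_mem) hu1 inner_t₁_u₀

end Core

end HRowEndModel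

end Summit.Ventures.Crystal3D.Theorems

end
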